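import Literature.Probability.LatticeModels.PlaneRotatorTwistFluxPeriodicity
import HarnessLib

/-!
# Gauge covariance of the twisted plane rotator on ANY finite bond system:
# `Z_{J, s + ∇φ}(t) = Z_{J, s}(t)`, the twist modulus is a class function of `s mod gradients`,
# scales as `Q(c·s) = c²·Q(s)`, and vanishes on pure gauges (a global Ward identity)

Topic `Literature/Probability/LatticeModels`; companion of `PlaneRotatorHelicityModulus.lean` (p536677: the twisted
ensemble `Z_{J,s}(t) = ∫ exp(∑_a J_a cos(∇θ_a + t s_a)) dθ` of a finite bond system `G`, `BondSystem.twistPartitionFn`,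
and its modulus `Q(s) = (−log Z_{J,s})''(0) = BondSystem.twistModulus`), of `PlaneRotatorTwistFluxPeriodicity.lean`
(p542378: the torus instance — one flux quantum is a gauge transformation) and of
`PlaneRotatorStiffnessCutCovariance.lean` (p547164: cut-constant torus profiles via the dual current representation).
Everything PROVED; the one definition is bookkeeping (the bond gradient `∇φ` of a site function).

## Contents

* §1 **Gauge transformations.** For a site function `φ : V → ℝ` the change of variables `θ_v ↦ θ_v·e^{i t φ_v}`
  multiplies every bond character by `e^{i t (∇φ)_a}`, `(∇φ)_a = φ(tgt a) − φ(src a)` (`bondChar_mul_gauge`), hence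
  shifts the twist profile, `H_{s,t}(θ·g) = H_{s + ∇φ, t}(θ)` (`twistHamiltonian_mul_gauge`); the Haar measure of
  `U(1)^V` is translation invariant, so **`Z_{J, s+∇φ}(t) = Z_{J, s}(t)` for every `t`** (`twistPartitionFn_gauge`;
  `twistPartitionFn_eq_of_sub_eq_grad`) and **`Q(s + ∇φ) = Q(s)`** (`twistModulus_gauge`) — Fisher–Barber–Jasnow's
  «a twist imposed on the boundary is equivalent to a uniform phase gradient», as an identity of the finite-volume
  partition function for an ARBITRARY redistribution of the twist along gradients, on any graph.
* §2 **Pure gauges carry no stiffness**: `Z_{J, ∇φ}(t) = Z(J)` (`twistPartitionFn_grad`), `Q(∇φ) = 0`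
  (`twistModulus_grad`), i.e. the **global Ward identity** `∑_a J_a (∇φ)_a² ⟨cos ∇θ_a⟩_J = ⟨(∑_a J_a (∇φ)_a sin ∇θ_a)²⟩_J`
  for every test function `φ` (`sum_grad_sq_expectJ_reChar_eq`) — Aizenman–Simon's local Ward identity
  `⟨∂²_x H⟩ = ⟨(∂_x H)²⟩` is the case `φ = δ_x` (tree `BondSystem.sum_siteCharge_sq_energy_eq`).
* §3 **Scaling and the chain rule.** `Z_{J, c·s}(t) = Z_{J, s}(ct)` (`twistPartitionFn_smul`); in general, for two
  bond systems, `Z'_{s'}(t) = Z_s(ct)` for all `t` implies `Q'(s') = c²·Q(s)` (`twistModulus_eq_mul_sq_of_twistPartitionFn_eq`,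
  the chain rule + uniqueness of derivatives, with the tree's `hasDerivAt_negLog_twistPartitionFn` /
  `hasDerivAt_twistFreeEnergyDeriv_zero` — the step `PlaneRotatorStiffnessCutCovariance.lean` performs inline for the
  torus); hence `Q(c·s) = c²·Q(s)` (`twistModulus_smul`) and **`Q(c·s + ∇φ) = c²·Q(s)`** (`twistModulus_eq_mul_sq_of_gauge`):
  the twist modulus depends on the profile only through its class modulo gradients, quadratically.

Reading (cell `pub/hubbard-tc`, MO-S3, crux №2 classical side): the general lemma behind the torus statements
«boundary twist ≡ uniform twist» (`twistPartitionFn_cutTwistProfile_eq`, dual route) and «one flux quantum is a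
gauge» (`torusXY_twistPartitionFn_add_fluxQuantum`); nothing numerical.

## What this is not

Finite-volume identities of the classical plane rotator; no inequality, no temperature regime, no thermodynamic
limit, nothing electronic; no number of the cell's tables moves.

## References

* M. E. Fisher, M. N. Barber, D. Jasnow, Phys. Rev. A 8 (1973) 1111–1124, §II eqs. (2.3)–(2.5) (twisted boundary
  conditions; equivalence with a uniform phase gradient; helicity modulus quadratic in the total twist).
  [FisherBarberJasnow1973]
* A. W. Sandvik, AIP Conf. Proc. 1297 (2010) 135, arXiv:1101.3281, §(spin stiffness) pp. 26–27 (twisted boundary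
  condition ≡ uniform twist field by the substitution `θ_j ↦ θ_j + jΦ/L`). [Sandvik2010]
* M. Aizenman, B. Simon, Comm. Math. Phys. 77 (1980) 137–143, eq. (2.4) (local Ward identity, rotation of one
  spin). [AizenmanSimon1980LocalWard]

Tree: `BondSystem.twistHamiltonian/twistWeight/twistPartitionFn/twistFreeEnergyDeriv/twistModulus`,
`twistWeight_zero`, `twistPartitionFn_zero`, `hasDerivAt_negLog_twistPartitionFn`, `hasDerivAt_twistFreeEnergyDeriv_zero`,
`iteratedDeriv_two_negLog_twistPartitionFn`, `expectJ_twistCurrent_eq_zero`, `cos_mul_reChar_sub_sin_mul_imChar`,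
`integral_torusHaar_mul_right`; Mathlib `Circle.exp_add/_sub`, `HasDerivAt.comp/.unique`, `iteratedDeriv_succ`.
-/

noncomputable section

open MeasureTheory Finset Filter
open scoped BigOperators Topology

namespace Literature.Probability.LatticeModels

namespace BondSystem

variable {V ι : Type*} (G : BondSystem V ι)

/-! ## §1 Gauge transformations shift the twist profile by a gradient -/

section Gauge

/-- The **bond gradient** `(∇φ)_a = φ(tgt a) − φ(src a)` of a site function `φ : V → ℝ` (a pure-gauge twist
profile). [cite: FisherBarberJasnow1973, §II eqs. (2.3)–(2.5) (uniform phase gradient)] -/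
def grad (φ : V → ℝ) (a : ι) : ℝ :=
  φ (G.tgt a) - φ (G.src a)

/-- `∇(φ + ψ) = ∇φ + ∇ψ`. [cite: FisherBarberJasnow1973, §II eqs. (2.3)–(2.5)] -/
theorem grad_add (φ ψ : V → ℝ) : G.grad (φ + ψ) = G.grad φ + G.grad ψ := by
  funext a; simp only [grad, Pi.add_apply]; ring

/-- `∇(c·φ) = c·∇φ`. [cite: FisherBarberJasnow1973, §II eqs. (2.3)–(2.5)] -/
theorem grad_smul (c : ℝ) (φ : V → ℝ) : G.grad (c • φ) = c • G.grad φ := by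
  funext a; simp only [grad, Pi.smul_apply, smul_eq_mul]; ring

/-- `∇φ = 0` for a constant `φ`. [cite: FisherBarberJasnow1973, §II eqs. (2.3)–(2.5)] -/
theorem grad_const (c : ℝ) : G.grad (fun _ : V => c) = 0 := by
  funext a; simp [grad]

/-- **Bond characters under the gauge transformation** `θ_v ↦ θ_v·e^{itφ_v}`:
`χ_a(θ·g) = χ_a(θ)·e^{it(∇φ)_a}`. [cite: FisherBarberJasnow1973, §II eqs. (2.3)–(2.5) (gauge equivalence of a boundary twist and the uniform phase gradient)] -/
theorem bondChar_mul_gauge (φ : V → ℝ) (t : ℝ) (θ : V → Circle) (a : ι) :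
    G.bondChar a (θ * fun v => Circle.exp (t * φ v)) = G.bondChar a θ * Circle.exp (t * G.grad φ a) := by
  change (θ (G.src a) * Circle.exp (t * φ (G.src a)))⁻¹ * (θ (G.tgt a) * Circle.exp (t * φ (G.tgt a))) =
    (θ (G.src a))⁻¹ * θ (G.tgt a) * Circle.exp (t * G.grad φ a)
  rw [mul_inv, mul_mul_mul_comm]
  congr 1
  rw [grad, mul_sub, Circle.exp_sub, div_eq_mul_inv, mul_comm]

variable [Fintype ι] (J s : ι → ℝ)

/-- **Gauge covariance of the twisted Hamiltonian**: `H_{s,t}(θ·g) = H_{s+∇φ,t}(θ)` for the gauge function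
`g_v = e^{itφ_v}`. [cite: FisherBarberJasnow1973, §II eqs. (2.3)–(2.5) (gauge equivalence of a boundary twist and the uniform phase gradient)] -/
theorem twistHamiltonian_mul_gauge (φ : V → ℝ) (t : ℝ) (θ : V → Circle) :
    G.twistHamiltonian J s t (θ * fun v => Circle.exp (t * φ v)) = G.twistHamiltonian J (s + G.grad φ) t θ := by
  unfold twistHamiltonian
  refine Finset.sum_congr rfl fun a _ => ?_
  congr 1
  rw [cos_mul_reChar_sub_sin_mul_imChar, cos_mul_reChar_sub_sin_mul_imChar, bondChar_mul_gauge,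
    mul_left_comm, ← Circle.exp_add, mul_comm (G.bondChar a θ), Pi.add_apply, mul_add]

/-- The twisted weight under the gauge transformation: `e^{H_{s,t}(θ·g)} = e^{H_{s+∇φ,t}(θ)}`.
[cite: FisherBarberJasnow1973, §II eqs. (2.3)–(2.5)] -/
theorem twistWeight_mul_gauge (φ : V → ℝ) (t : ℝ) (θ : V → Circle) :
    G.twistWeight J s t (θ * fun v => Circle.exp (t * φ v)) = G.twistWeight J (s + G.grad φ) t θ := by
  simp only [twistWeight, twistHamiltonian_mul_gauge]

/-- A zero twist profile at any amplitude is no twist: `e^{H_{0,t}} = w_J`. [cite: FisherBarberJasnow1973, §II eqs. (2.4)–(2.5)] -/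
theorem twistWeight_zero_profile (t : ℝ) (θ : V → Circle) : G.twistWeight J 0 t θ = G.weightJ J θ := by
  rw [← G.twistWeight_zero J 0 θ]
  simp [twistWeight, twistHamiltonian]

variable [Fintype V] [MeasurableSpace Circle] [BorelSpace Circle]

/-- **Gauge covariance of the twisted partition function**: `Z_{J, s+∇φ}(t) = Z_{J, s}(t)` for every finite bond
system, couplings `J`, twist profile `s`, site function `φ` and amplitude `t` — the change of variables
`θ_v ↦ θ_v e^{itφ_v}` and the translation invariance of the Haar measure of `U(1)^V`. [cite: FisherBarberJasnow1973, §II eqs. (2.3)–(2.5) (a twist of the boundary condition is equivalent to a uniform phase gradient)] -/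
theorem twistPartitionFn_gauge (φ : V → ℝ) (t : ℝ) :
    G.twistPartitionFn J (s + G.grad φ) t = G.twistPartitionFn J s t := by
  rw [twistPartitionFn, twistPartitionFn,
    ← integral_torusHaar_mul_right (fun θ => G.twistWeight J s t θ) (fun v => Circle.exp (t * φ v))]
  refine integral_congr_ae (ae_of_all _ fun θ => ?_)
  simp only [twistWeight_mul_gauge]

/-- Two twist profiles that differ by a gradient have the same twisted partition function. [cite: Sandvik2010, §(spin stiffness) pp. 26–27 of arXiv:1101.3281 (twisted boundary ≡ uniform twist field)] -/
theorem twistPartitionFn_eq_of_sub_eq_grad {s s' : ι → ℝ} {φ : V → ℝ} (h : s' - s = G.grad φ) (t : ℝ) :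
    G.twistPartitionFn J s' t = G.twistPartitionFn J s t := by
  obtain rfl : s' = s + G.grad φ := by rw [← h]; abel
  exact G.twistPartitionFn_gauge J s φ t

/-- The twist free energy is gauge invariant: `−log Z_{J,s+∇φ}(t) = −log Z_{J,s}(t)`. [cite: FisherBarberJasnow1973, §II eqs. (2.3)–(2.5)] -/
theorem negLog_twistPartitionFn_gauge (φ : V → ℝ) :
    (fun t => -Real.log (G.twistPartitionFn J (s + G.grad φ) t)) =
      fun t => -Real.log (G.twistPartitionFn J s t) :=
  funext fun t => by rw [twistPartitionFn_gauge]

/-- **The twist modulus is gauge invariant**: `Q(s + ∇φ) = Q(s)` (`Q = (−log Z)''(0)`, tree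
`iteratedDeriv_two_negLog_twistPartitionFn`). [cite: FisherBarberJasnow1973, §II eqs. (2.4)–(2.5) (helicity modulus independent of how the twist is distributed)] -/
theorem twistModulus_gauge (φ : V → ℝ) : G.twistModulus J (s + G.grad φ) = G.twistModulus J s := by
  rw [← G.iteratedDeriv_two_negLog_twistPartitionFn J (s + G.grad φ),
    ← G.iteratedDeriv_two_negLog_twistPartitionFn J s, negLog_twistPartitionFn_gauge]

/-- Class-function form: `s' − s = ∇φ ⇒ Q(s') = Q(s)`. [cite: FisherBarberJasnow1973, §II eqs. (2.4)–(2.5)] -/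
theorem twistModulus_eq_of_sub_eq_grad {s s' : ι → ℝ} {φ : V → ℝ} (h : s' - s = G.grad φ) :
    G.twistModulus J s' = G.twistModulus J s := by
  obtain rfl : s' = s + G.grad φ := by rw [← h]; abel
  exact G.twistModulus_gauge J s φ

/-! ## §2 Pure gauges: `Z_{J,∇φ}(t) = Z(J)`, `Q(∇φ) = 0` — the global Ward identity -/

/-- **A pure-gauge twist costs nothing**: `Z_{J, ∇φ}(t) = Z(J)` for every `t`. [cite: FisherBarberJasnow1973, §II eqs. (2.3)–(2.5)] -/
theorem twistPartitionFn_grad (φ : V → ℝ) (t : ℝ) : G.twistPartitionFn J (G.grad φ) t = G.partitionFnJ J := by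
  have h := G.twistPartitionFn_gauge J 0 φ t
  rw [zero_add] at h
  rw [h, twistPartitionFn, partitionFnJ]
  exact integral_congr_ae (ae_of_all _ fun θ => G.twistWeight_zero_profile J t θ)

/-- **A pure-gauge twist has zero modulus**: `Q(∇φ) = 0`. [cite: FisherBarberJasnow1973, §II eqs. (2.4)–(2.5)] -/
theorem twistModulus_grad (φ : V → ℝ) : G.twistModulus J (G.grad φ) = 0 := by
  rw [← G.iteratedDeriv_two_negLog_twistPartitionFn J (G.grad φ)]
  have hconst : (fun t => -Real.log (G.twistPartitionFn J (G.grad φ) t)) = fun _ => -Real.log (G.partitionFnJ J) :=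
    funext fun t => by rw [twistPartitionFn_grad]
  rw [hconst, iteratedDeriv_const]
  simp

/-- **The global Ward identity of the plane rotator**: for every finite bond system, real couplings `J` and test
function `φ : V → ℝ`,
`∑_a J_a (∇φ)_a² ⟨cos ∇θ_a⟩_J = ⟨(∑_a J_a (∇φ)_a sin ∇θ_a)²⟩_J`
(the `O(t²)` coefficient of `Z_{J,∇φ}(t) = Z(J)`; `⟨𝒥_{∇φ}⟩_J = 0` by `expectJ_twistCurrent_eq_zero`). For `φ = δ_x`
this is Aizenman–Simon's local Ward identity `⟨∂²_x H⟩ = ⟨(∂_x H)²⟩` (tree `sum_siteCharge_sq_energy_eq`).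
[cite: AizenmanSimon1980LocalWard, eq. (2.4) (local Ward identity; here summed against an arbitrary test function)] -/
theorem sum_grad_sq_expectJ_reChar_eq (φ : V → ℝ) :
    ∑ a, J a * G.grad φ a ^ 2 * G.expectJ J (reChar (G.bondChar a)) =
      G.expectJ J (fun θ => G.twistCurrent J (G.grad φ) θ ^ 2) := by
  have h := G.twistModulus_grad J φ
  rw [twistModulus, expectJ_twistCurrent_eq_zero] at h
  linear_combination h

end Gauge

/-! ## §3 Scaling of the profile and the chain rule for the modulus -/

section Scaling

variable [Fintype ι] (J s : ι → ℝ)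

/-- `H_{c·s, t} = H_{s, ct}`. [cite: FisherBarberJasnow1973, §II eqs. (2.4)–(2.5)] -/
theorem twistHamiltonian_smul (c t : ℝ) (θ : V → Circle) :
    G.twistHamiltonian J (c • s) t θ = G.twistHamiltonian J s (c * t) θ := by
  unfold twistHamiltonian
  refine Finset.sum_congr rfl fun a _ => ?_
  rw [Pi.smul_apply, smul_eq_mul, show t * (c * s a) = c * t * s a by ring]

/-- `e^{H_{c·s, t}} = e^{H_{s, ct}}`. [cite: FisherBarberJasnow1973, §II eqs. (2.4)–(2.5)] -/
theorem twistWeight_smul (c t : ℝ) (θ : V → Circle) :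
    G.twistWeight J (c • s) t θ = G.twistWeight J s (c * t) θ := by
  simp only [twistWeight, twistHamiltonian_smul]

variable [Fintype V] [MeasurableSpace Circle] [BorelSpace Circle]

/-- **Scaling**: `Z_{J, c·s}(t) = Z_{J, s}(ct)`. [cite: FisherBarberJasnow1973, §II eqs. (2.4)–(2.5) (the response depends on the total twist)] -/
theorem twistPartitionFn_smul (c t : ℝ) : G.twistPartitionFn J (c • s) t = G.twistPartitionFn J s (c * t) := by
  simp only [twistPartitionFn, twistWeight_smul]

/-- **The chain rule for the twist modulus** (two bond systems `G`, `G'`): if `Z'_{J',s'}(t) = Z_{J,s}(ct)` for all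
`t`, then `Q'(s') = c²·Q(s)` — `−log Z'_{s'} = (−log Z_s) ∘ (c·)`, differentiate twice at `0` (tree
`hasDerivAt_negLog_twistPartitionFn`, `hasDerivAt_twistFreeEnergyDeriv_zero`, uniqueness of derivatives).
[cite: FisherBarberJasnow1973, §II eqs. (2.4)–(2.5) (helicity modulus = quadratic response in the total twist)] -/
theorem twistModulus_eq_mul_sq_of_twistPartitionFn_eq {V' ι' : Type*} [Fintype V'] [Fintype ι']
    (G' : BondSystem V' ι') (J' s' : ι' → ℝ) (c : ℝ)
    (h : ∀ t, G'.twistPartitionFn J' s' t = G.twistPartitionFn J s (c * t)) :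
    G'.twistModulus J' s' = c ^ 2 * G.twistModulus J s := by
  -- first derivatives: `F'_{s'}(t) = c · F'_s(c t)`
  have hderiv : ∀ t, G'.twistFreeEnergyDeriv J' s' t = c * G.twistFreeEnergyDeriv J s (c * t) := fun t => by
    have h1 := G'.hasDerivAt_negLog_twistPartitionFn J' s' t
    have h2 : HasDerivAt (fun t => -Real.log (G.twistPartitionFn J s (c * t)))
        (G.twistFreeEnergyDeriv J s (c * t) * c) t := by
      have hin : HasDerivAt (fun t : ℝ => c * t) c t := by simpa using (hasDerivAt_id t).const_mul c
      exact (G.hasDerivAt_negLog_twistPartitionFn J s (c * t)).comp t hin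
    have hfun : (fun t => -Real.log (G'.twistPartitionFn J' s' t)) =
        fun t => -Real.log (G.twistPartitionFn J s (c * t)) := funext fun t => by rw [h t]
    rw [hfun] at h1
    rw [h1.unique h2, mul_comm]
  -- second derivative at zero
  have h3 := G'.hasDerivAt_twistFreeEnergyDeriv_zero J' s'
  have h4 : HasDerivAt (fun t => c * G.twistFreeEnergyDeriv J s (c * t)) (c * (G.twistModulus J s * c)) 0 := by
    have hin : HasDerivAt (fun t : ℝ => c * t) c 0 := by simpa using (hasDerivAt_id (0 : ℝ)).const_mul c
    have h0 := G.hasDerivAt_twistFreeEnergyDeriv_zero J s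
    rw [show (0 : ℝ) = c * 0 by ring] at h0
    exact (h0.comp 0 hin).const_mul c
  have hfun2 : G'.twistFreeEnergyDeriv J' s' = fun t => c * G.twistFreeEnergyDeriv J s (c * t) := funext hderiv
  rw [hfun2] at h3
  rw [h3.unique h4]
  ring

/-- **Quadratic scaling of the modulus**: `Q(c·s) = c²·Q(s)`. [cite: FisherBarberJasnow1973, §II eqs. (2.4)–(2.5) (helicity modulus = quadratic response in the total twist)] -/
theorem twistModulus_smul (c : ℝ) : G.twistModulus J (c • s) = c ^ 2 * G.twistModulus J s :=
  G.twistModulus_eq_mul_sq_of_twistPartitionFn_eq J s G J (c • s) c fun t => G.twistPartitionFn_smul J s c t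

/-- **Gauge class + scaling**: if `s' = c·s + ∇φ` then `Z_{J,s'}(t) = Z_{J,s}(ct)` for all `t`. [cite: Sandvik2010, §(spin stiffness) pp. 26–27 of arXiv:1101.3281 (twisted boundary ≡ uniform twist field)] -/
theorem twistPartitionFn_eq_of_gauge {s' : ι → ℝ} {c : ℝ} {φ : V → ℝ} (h : s' = c • s + G.grad φ) (t : ℝ) :
    G.twistPartitionFn J s' t = G.twistPartitionFn J s (c * t) := by
  subst h
  rw [twistPartitionFn_gauge, twistPartitionFn_smul]

/-- **Gauge class + scaling for the modulus**: if `s' = c·s + ∇φ` then `Q(s') = c²·Q(s)` — the twist modulus depends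
on the profile only through its class modulo gradients, quadratically. [cite: FisherBarberJasnow1973, §II eqs. (2.4)–(2.5) (helicity modulus = quadratic response in the total twist)] -/
theorem twistModulus_eq_mul_sq_of_gauge {s' : ι → ℝ} {c : ℝ} {φ : V → ℝ} (h : s' = c • s + G.grad φ) :
    G.twistModulus J s' = c ^ 2 * G.twistModulus J s := by
  subst h
  rw [twistModulus_gauge, twistModulus_smul]

end Scaling

end BondSystem

end Literature.Probability.LatticeModels
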